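/-
Copyright: public-domain mathematics; formalisation produced inside the b2b autopsy cell `lwe-quantum-autopsy`
(Part 1, generation 17).  Source analysed: Yilei Chen, "Quantum Algorithms for Lattice Problems",
IACR ePrint 2024/555, version of 2024-04-18 (WITHDRAWN by the author: "Step 9 of the algorithm contains a
bug, which I don't know how to fix").  Bib key `ChenQuantumLattice2024`.
REPRODUCTION / ANALYSIS OF A CLAIMED RESULT UNDER ADJUDICATION (withdrawn).  HONEST FRAMING: a theorem about
the measurement step of a withdrawn algorithm; it repairs nothing, breaks nothing, and is not progress on any
lattice problem or on the summit `QuantumAdvantage` — its value is a precise, kernel-checked constant.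
-/
import Literature.Computability.Cryptography.ChenQuantumLWEThresholdPrimeExact

/-!
# The Step-8 tolerance threshold is `1/(Q² + 1)` for EVERY admissible prime `Q`

Module (AC) `ChenQuantumLWEThresholdPrimeExact` proved: for `q ≥ 13` mutually unbiased orthogonal frames of
size `q²` (`MUBFrames q a z`), a general measurement that is `ε`-almost sure on every frame vector with
`ε·(q² + 1) < 1` has ONE almost-certain outcome on all of them (`MUBFrames.sameOutcome`), and deduced that the
tolerance threshold of Chen's Step 8 for prime `Q ≥ 13` is exactly `1/(Q² + 1)`; for the admissible primes
`Q ∈ {3, 5, 7, 11}` only the window `[1/(4Q²), 1/(Q² + 1)]` of (Q)/(AC) was known, because the Gram step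
`H ≥ 6` of (AC) needs `q ≥ 13`.

This module removes the hypothesis `13 ≤ q`: `MUBFrames.sameOutcome₃` holds for every `q ≥ 3`
(so for every odd prime), by a different, inverse-free argument — a HILBERT–SCHMIDT CAUCHY–SCHWARZ step.
Fix an outcome `A` with effect `C`, let `W_r` be the set of `A`-high vectors of family `r` (all of the same
size `h ≥ 1`, `MUBFrames.card_high_le`), `𝔖 = Σ_r Σ_{j ∈ W_r} ⟨z_{r,j}|C|z_{r,j}⟩ ≥ qh(1 − ε)a`, `𝒯` the
(family-independent) frame trace `Σ_j ⟨z_{r,j}|C|z_{r,j}⟩ ≤ (𝔖 + q(q² − h)εa)/q`, and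
`G = Σ_{p,p′ high} ‖⟨u_p|u_{p′}⟩‖² ≤ a²h(q² + (q − 1)h)/q` (mutual unbiasedness).  In the coordinates of ONE
frame `(O_j)`, with `c_{jj′} = ⟨O_j|C|O_{j′}⟩` and `π_{jj′} = Σ_p ⟨O_j|u_p⟩⟨u_p|O_{j′}⟩`:
`Σ conj(c)·π = a²·Σ_p ⟨u_p|C|u_p⟩` and `Σ ‖π‖² = a²G` (resolution of the identity on the span, twice),
`Σ ‖c‖² ≤ a𝒯` (Bessel's inequality and `‖Cx‖² ≤ ⟨x|C|x⟩`), so Cauchy–Schwarz on `J × J` gives the CORE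
INEQUALITY `𝔖² ≤ (𝒯/a)·G` (`sq_sum_weight_le`).  Eliminating `𝔖, 𝒯, G` yields, for `2h ≤ q²`,
`h q³ (1 − ε)² ≤ (q² + (q − 1)h)(h(1 − ε) + (q² − h)ε)` (`MUBFrames.key_ineq`), which contradicts
`ε(q² + 1) < 1` for all `q ≥ 3`, `1 ≤ h ≤ q²/2` through the polynomial inequality
`h q⁷ ≥ (q² + 1)(q²(h + 1) − h)(q² + (q − 1)h)` (`key_poly_nonneg`; the polynomial inequality FAILS for
`q = 2` — two unbiased bases of `ℂ⁴` — which the method therefore does not cover; not needed, `Q` is odd).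
Hence every occurring outcome is high on MORE THAN HALF of every family (`MUBFrames.half_lt_card₃`) and two
outcomes cannot coexist.

Consequences for Chen's Step 8 (namespace `Shape`, verbatim the (AC) statements WITHOUT `13 ≤ Q`):
`step8_povm_ceiling_prime'`, `step8_povm_ceiling_threshold_prime'` (ceiling below `1/(Q² + 1)` AND failure at
`1/(Q² + 1)`, i.e. the threshold is EXACTLY `1/(Q² + 1)` for every admissible prime `Q ≥ 3`), and the
half-line form `step8_povm_sameOutcome_iff_lt_threshold'`.  The composite-`Q` exact constant stays open
(window `[1/(4Q²), 1/(minFac(Q)² + 1)]` of (Q)/(AC)).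

## What is NOT claimed

* Composite `Q`: ceiling `32ε𝔭(Q)² ≤ 1` of (Z), failure at `min(1/𝔭(Q)², 1/(minFac(Q)² + 1))` ((Y), (AC)) —
  the exact constant is open.  Measurements with more than two outcomes AT `ε ≥ 1/(Q² + 1)`: only the
  two-outcome `iff` is stated.  `q = 2` (two unbiased bases of `ℂ⁴`): not covered by the method, and not
  needed (`Q` is odd).
* Nothing here bears on Steps 1–7 (the complex-Gaussian front end is the black box (N)
  `ChenQuantumLWEStepEight` records) or on the Step-9 bug itself.

Nearest literature: perfect ANTIDISTINGUISHABILITY / conclusive exclusion of states drawn from mutually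
unbiased bases (Caves–Fuchs–Schack 2002; Bandyopadhyay–Jain–Oppenheim–Strelchuk 2014; Leifer–Duarte,
Phys. Rev. A 101 (2020) 062113, Ex. 5.3) treats the `ε = 0`/exclusion side; the `ε`-almost-sure ⇒ CONSTANT
threshold `1/(q² + 1)` for `q` MUBs of a `q²`-space is, as far as we searched, not in print — it is in any
case elementary, and recorded here only as the adjudicated constant of a withdrawn algorithm's Step 8.

References: [cite: ChenQuantumLattice2024, Lemma 3.13 pp. 32–34, eq. (35) p. 31, §3.5.8 pp. 33–34,
§3.5.5 pp. 33–37]; [cite: NielsenChuang2010, §2.2.6 p. 90 (POVM formalism), Box 2.3 p. 87 (completeness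
relation, Cauchy–Schwarz)].
-/

open scoped BigOperators ComplexOrder MatrixOrder
open Matrix Finset

namespace Literature.Computability.Cryptography.Chen2024

/-! ## Part I.  A positive semidefinite form against an orthogonal frame -/

section LA

variable {X : Type*} [Fintype X] [DecidableEq X]

/-- `conj ⟨x|A|y⟩ = ⟨y|A|x⟩` for `A ⪰ 0`. [folklore] -/
theorem conj_star_dotProduct_mulVec {A : Matrix X X ℂ} (hA : A.PosSemidef) (x y : X → ℂ) :
    (starRingEnd ℂ) (star x ⬝ᵥ (A *ᵥ y)) = star y ⬝ᵥ (A *ᵥ x) := by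
  obtain ⟨B, hB⟩ := exists_form_eq_of_posSemidef hA
  rw [hB, hB, conj_star_dotProduct]

omit [DecidableEq X] in
/-- `⟨x|A|y⟩ = ⟨A x|y⟩` for `A ⪰ 0`. [folklore] -/
theorem star_dotProduct_mulVec_eq_star_mulVec_dotProduct {A : Matrix X X ℂ} (hA : A.PosSemidef)
    (x y : X → ℂ) : star x ⬝ᵥ (A *ᵥ y) = star (A *ᵥ x) ⬝ᵥ y := by
  have hH : Aᴴ = A := hA.isHermitian
  calc star x ⬝ᵥ (A *ᵥ y) = (star x ᵥ* A) ⬝ᵥ y := dotProduct_mulVec _ _ _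
    _ = star (A *ᵥ x) ⬝ᵥ y := by rw [star_mulVec, hH]

namespace POVM

variable {κ : Type*} [Fintype κ] (E : POVM X κ)

/-- **An effect is dominated by its own form:** `‖E_k x‖² ≤ ⟨x|E_k|x⟩` (`E_k² ≤ E_k` since `0 ≤ E_k ≤ 1`).
[cite: NielsenChuang2010, §2.2.6 p. 90] -/
theorem re_star_mulVec_self_le [DecidableEq κ] (x : X → ℂ) (k : κ) :
    (star (E.effect k *ᵥ x) ⬝ᵥ (E.effect k *ᵥ x)).re ≤ (E.weight x k).re := by
  have hCS := norm_sq_dotProduct_mulVec_le (E.posSemidef k) (E.effect k *ᵥ x) x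
  have hw := E.weight_re_le (E.effect k *ᵥ x) k
  unfold POVM.weight at hw ⊢
  have hr0 := star_dotProduct_self_re_nonneg (E.effect k *ᵥ x)
  have ht0 : 0 ≤ (star x ⬝ᵥ (E.effect k *ᵥ x)).re := E.weight_re_nonneg x k
  have hn : ‖star (E.effect k *ᵥ x) ⬝ᵥ (E.effect k *ᵥ x)‖
      = (star (E.effect k *ᵥ x) ⬝ᵥ (E.effect k *ᵥ x)).re := by
    rw [star_dotProduct_self_eq_re (E.effect k *ᵥ x), Complex.norm_real, Complex.ofReal_re,
      Real.norm_of_nonneg hr0]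
  rw [hn] at hCS
  have h2 := hCS.trans (mul_le_mul_of_nonneg_right hw ht0)
  nlinarith

end POVM

variable {J : Type*} [Fintype J] [DecidableEq J]

omit [DecidableEq X] [DecidableEq J] in
/-- **Resolution of the identity on the span:** `Σ_j ⟨x|O_j⟩⟨O_j|y⟩ = a·⟨x|y⟩` when `y` lies in the span of the
orthogonal family `(O_j)` of common norm² `a`. [cite: NielsenChuang2010, Box 2.3 p. 87] -/
theorem sum_dotProduct_mul_dotProduct (O : J → X → ℂ) {a : ℝ} (ha : 0 < a) (x y : X → ℂ)
    (hy : y = frameProj O a y) :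
    ∑ j, (star x ⬝ᵥ O j) * (star (O j) ⬝ᵥ y) = ((a : ℂ)) * (star x ⬝ᵥ y) := by
  have h := star_dotProduct_frameProj O a y x
  rw [← hy] at h
  rw [h, Finset.mul_sum]
  refine Finset.sum_congr rfl fun j _ => ?_
  have ha0 : ((a : ℂ)) ≠ 0 := by exact_mod_cast ha.ne'
  field_simp

omit [DecidableEq X] [DecidableEq J] in
/-- The conjugate form: `Σ_j ⟨y|O_j⟩⟨O_j|x⟩ = a·⟨y|x⟩` for `y` in the span. [cite: NielsenChuang2010, Box 2.3 p. 87] -/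
theorem sum_dotProduct_mul_dotProduct' (O : J → X → ℂ) {a : ℝ} (ha : 0 < a) (x y : X → ℂ)
    (hy : y = frameProj O a y) :
    ∑ j, (star y ⬝ᵥ O j) * (star (O j) ⬝ᵥ x) = ((a : ℂ)) * (star y ⬝ᵥ x) := by
  have h := congrArg (starRingEnd ℂ) (sum_dotProduct_mul_dotProduct O ha x y hy)
  simp only [map_sum, map_mul, conj_star_dotProduct, Complex.conj_ofReal] at h
  rw [← h]
  exact Finset.sum_congr rfl fun j _ => mul_comm _ _

omit [DecidableEq X] in
/-- **Bessel's inequality** for an orthogonal family of common norm² `a > 0`: `Σ_j ‖⟨O_j|x⟩‖² ≤ a·⟨x|x⟩`.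
[cite: NielsenChuang2010, Box 2.3 p. 87] -/
theorem sum_normSq_dotProduct_le (O : J → X → ℂ) {a : ℝ} (ha : 0 < a)
    (hO : ∀ j j', star (O j) ⬝ᵥ O j' = if j = j' then ((a : ℂ)) else 0) (x : X → ℂ) :
    ∑ j, ‖star (O j) ⬝ᵥ x‖ ^ 2 ≤ a * (star x ⬝ᵥ x).re := by
  have h1 := star_frameProj_self O ha hO x
  have h2 := star_frameProj_dotProduct_sub O ha hO x
  have hPx : star (frameProj O a x) ⬝ᵥ x = ((a⁻¹ * ∑ j, ‖star (O j) ⬝ᵥ x‖ ^ 2 : ℝ) : ℂ) := by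
    have e : star (frameProj O a x) ⬝ᵥ x
        = star (frameProj O a x) ⬝ᵥ (x - frameProj O a x) + star (frameProj O a x) ⬝ᵥ frameProj O a x := by
      rw [dotProduct_sub]; ring
    rw [e, h2, h1, zero_add]
  have hxP : star x ⬝ᵥ frameProj O a x = ((a⁻¹ * ∑ j, ‖star (O j) ⬝ᵥ x‖ ^ 2 : ℝ) : ℂ) := by
    rw [← conj_star_dotProduct (frameProj O a x) x, hPx, Complex.conj_ofReal]
  have hres := star_dotProduct_self_re_nonneg (x - frameProj O a x)
  have hre : (star (x - frameProj O a x) ⬝ᵥ (x - frameProj O a x)).re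
      = (star x ⬝ᵥ x).re - a⁻¹ * ∑ j, ‖star (O j) ⬝ᵥ x‖ ^ 2 := by
    rw [star_sub, sub_dotProduct, dotProduct_sub, dotProduct_sub, hxP, hPx, h1]
    simp only [Complex.sub_re, Complex.ofReal_re]
    ring
  rw [hre] at hres
  have h3 : a⁻¹ * ∑ j, ‖star (O j) ⬝ᵥ x‖ ^ 2 ≤ (star x ⬝ᵥ x).re := by linarith
  calc ∑ j, ‖star (O j) ⬝ᵥ x‖ ^ 2 = a * (a⁻¹ * ∑ j, ‖star (O j) ⬝ᵥ x‖ ^ 2) := by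
        rw [← mul_assoc, mul_inv_cancel₀ ha.ne', one_mul]
    _ ≤ a * (star x ⬝ᵥ x).re := mul_le_mul_of_nonneg_left h3 ha.le

omit [DecidableEq X] in
/-- The form of the frame effect sum `Σ_p |u_p⟩⟨u_p|/⟨u_p|u_p⟩` of vectors of common norm² `a`:
`⟨x|Σ_p Π_p|y⟩ = a⁻¹·Σ_p ⟨x|u_p⟩⟨u_p|y⟩`. [cite: NielsenChuang2010, §2.2.6 p. 90] -/
theorem star_dotProduct_sum_projEffect_mulVec {P : Type*} [Fintype P] (u : P → X → ℂ) {a : ℝ}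
    (hu : ∀ p, (star (u p) ⬝ᵥ u p).re = a) (x y : X → ℂ) :
    star x ⬝ᵥ ((∑ p, projEffect (u p)) *ᵥ y) = ((a : ℂ))⁻¹ * ∑ p, (star x ⬝ᵥ u p) * (star (u p) ⬝ᵥ y) := by
  rw [Matrix.sum_mulVec, dotProduct_sum, Finset.mul_sum]
  refine Finset.sum_congr rfl fun p _ => ?_
  rw [dotProduct_projEffect_mulVec, hu p]
  push_cast
  ring

omit [DecidableEq J] in
/-- **The trace identity behind the Hilbert–Schmidt pairing.**  For `A ⪰ 0`, an orthogonal frame `(O_j)` of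
common norm² `a > 0`, and vectors `u_p` in its span:
`Σ_{j,j′} conj⟨O_j|A|O_{j′}⟩ · Σ_p ⟨O_j|u_p⟩⟨u_p|O_{j′}⟩ = a²·Σ_p ⟨u_p|A|u_p⟩` (the resolution of the identity,
used once in `j′` and once in `j`). [cite: NielsenChuang2010, Box 2.3 p. 87] -/
theorem sum_conj_form_mul_proj (O : J → X → ℂ) {a : ℝ} (ha : 0 < a) {A : Matrix X X ℂ}
    (hA : A.PosSemidef) {P : Type*} [Fintype P] (u : P → X → ℂ) (hu : ∀ p, u p = frameProj O a (u p)) :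
    ∑ j, ∑ j', (starRingEnd ℂ) (star (O j) ⬝ᵥ (A *ᵥ O j'))
        * ∑ p, (star (O j) ⬝ᵥ u p) * (star (u p) ⬝ᵥ O j')
      = ((a : ℂ)) ^ 2 * ∑ p, star (u p) ⬝ᵥ (A *ᵥ u p) := by
  -- `j′`-sum first: `Σ_{j′} ⟨u_p|O_{j′}⟩⟨O_{j′}|A O_j⟩ = a⟨u_p|A O_j⟩ = a⟨A u_p|O_j⟩`
  have inner : ∀ p j, ∑ j', (star (O j') ⬝ᵥ (A *ᵥ O j)) * ((star (O j) ⬝ᵥ u p) * (star (u p) ⬝ᵥ O j'))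
      = ((a : ℂ)) * ((star (A *ᵥ u p) ⬝ᵥ O j) * (star (O j) ⬝ᵥ u p)) := by
    intro p j
    have h := sum_dotProduct_mul_dotProduct' O ha (A *ᵥ O j) (u p) (hu p)
    rw [star_dotProduct_mulVec_eq_star_mulVec_dotProduct hA (u p) (O j)] at h
    calc ∑ j', (star (O j') ⬝ᵥ (A *ᵥ O j)) * ((star (O j) ⬝ᵥ u p) * (star (u p) ⬝ᵥ O j'))
        = (star (O j) ⬝ᵥ u p) * ∑ j', (star (u p) ⬝ᵥ O j') * (star (O j') ⬝ᵥ (A *ᵥ O j)) := by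
          rw [Finset.mul_sum]
          exact Finset.sum_congr rfl fun j' _ => by ring
      _ = _ := by rw [h]; ring
  -- `j`-sum next: `Σ_j ⟨A u_p|O_j⟩⟨O_j|u_p⟩ = a⟨A u_p|u_p⟩ = a⟨u_p|A|u_p⟩`
  have outer : ∀ p, ∑ j, ((a : ℂ)) * ((star (A *ᵥ u p) ⬝ᵥ O j) * (star (O j) ⬝ᵥ u p))
      = ((a : ℂ)) ^ 2 * (star (u p) ⬝ᵥ (A *ᵥ u p)) := by
    intro p
    rw [← Finset.mul_sum, sum_dotProduct_mul_dotProduct O ha (A *ᵥ u p) (u p) (hu p),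
      ← star_dotProduct_mulVec_eq_star_mulVec_dotProduct hA (u p) (u p)]
    ring
  calc ∑ j, ∑ j', (starRingEnd ℂ) (star (O j) ⬝ᵥ (A *ᵥ O j'))
          * ∑ p, (star (O j) ⬝ᵥ u p) * (star (u p) ⬝ᵥ O j')
        = ∑ j, ∑ j', ∑ p, (star (O j') ⬝ᵥ (A *ᵥ O j))
            * ((star (O j) ⬝ᵥ u p) * (star (u p) ⬝ᵥ O j')) := by
          refine Finset.sum_congr rfl fun j _ => Finset.sum_congr rfl fun j' _ => ?_
          rw [conj_star_dotProduct_mulVec hA, Finset.mul_sum]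
    _ = ∑ j, ∑ p, ∑ j', (star (O j') ⬝ᵥ (A *ᵥ O j))
            * ((star (O j) ⬝ᵥ u p) * (star (u p) ⬝ᵥ O j')) :=
          Finset.sum_congr rfl fun j _ => Finset.sum_comm
    _ = ∑ p, ∑ j, ∑ j', (star (O j') ⬝ᵥ (A *ᵥ O j))
            * ((star (O j) ⬝ᵥ u p) * (star (u p) ⬝ᵥ O j')) := Finset.sum_comm
    _ = ∑ p, ((a : ℂ)) ^ 2 * (star (u p) ⬝ᵥ (A *ᵥ u p)) := by
          refine Finset.sum_congr rfl fun p _ => ?_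
          rw [← outer p]
          exact Finset.sum_congr rfl fun j _ => inner p j
    _ = _ := by rw [Finset.mul_sum]

omit [DecidableEq J] in
/-- **Cauchy–Schwarz on `J × J`** in double-sum form. [folklore] -/
theorem norm_sq_sum_sum_conj_mul_le (f g : J → J → ℂ) :
    ‖∑ j, ∑ j', (starRingEnd ℂ) (f j j') * g j j'‖ ^ 2
      ≤ (∑ j, ∑ j', ‖f j j'‖ ^ 2) * ∑ j, ∑ j', ‖g j j'‖ ^ 2 := by
  have h := norm_sq_star_dotProduct_le (fun jj : J × J => f jj.1 jj.2) (fun jj : J × J => g jj.1 jj.2)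
  rw [re_star_dotProduct_self, re_star_dotProduct_self] at h
  simp only [dotProduct, Pi.star_apply, Complex.star_def, Fintype.sum_prod_type] at h
  exact h

/-- **The core inequality (Hilbert–Schmidt Cauchy–Schwarz).**  For a general measurement `E`, an outcome `k`,
an orthogonal frame `(O_j)` of common norm² `a > 0` and vectors `u_p` of norm² `a` in its span:
`(Σ_p ⟨u_p|E_k|u_p⟩)² ≤ (Σ_j ⟨O_j|E_k|O_j⟩ / a) · Σ_{p,p′} ‖⟨u_p|u_{p′}⟩‖²`.
[cite: NielsenChuang2010, §2.2.6 p. 90, Box 2.3 p. 87] -/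
theorem sq_sum_weight_le {κ : Type*} [Fintype κ] [DecidableEq κ] (E : POVM X κ) (k : κ)
    (O : J → X → ℂ) {a : ℝ} (ha : 0 < a)
    (hO : ∀ j j', star (O j) ⬝ᵥ O j' = if j = j' then ((a : ℂ)) else 0)
    {P : Type*} [Fintype P] (u : P → X → ℂ) (hu : ∀ p, u p = frameProj O a (u p))
    (hnorm : ∀ p, (star (u p) ⬝ᵥ u p).re = a) :
    (∑ p, (E.weight (u p) k).re) ^ 2
      ≤ (∑ j, (E.weight (O j) k).re) / a * ∑ p, ∑ p', ‖star (u p) ⬝ᵥ u p'‖ ^ 2 := by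
  have ha0 : ((a : ℂ)) ≠ 0 := by exact_mod_cast ha.ne'
  -- (E1) the pairing
  have hA := sum_conj_form_mul_proj O ha (E.posSemidef k) u hu
  -- (E2) the Hilbert–Schmidt norm of `π`, via the same identity for the PSD matrix `Σ_p |u_p⟩⟨u_p|/a`
  have hB : ∑ j, ∑ j', ‖∑ p, (star (O j) ⬝ᵥ u p) * (star (u p) ⬝ᵥ O j')‖ ^ 2
      = a ^ 2 * ∑ p, ∑ p', ‖star (u p) ⬝ᵥ u p'‖ ^ 2 := by
    have h := sum_conj_form_mul_proj O ha (POVM.posSemidef_sum_projEffect u) u hu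
    simp_rw [star_dotProduct_sum_projEffect_mulVec u hnorm] at h
    have h' : ∑ j, ∑ j', (starRingEnd ℂ) (∑ p, (star (O j) ⬝ᵥ u p) * (star (u p) ⬝ᵥ O j'))
        * ∑ p, (star (O j) ⬝ᵥ u p) * (star (u p) ⬝ᵥ O j')
        = ((a : ℂ)) ^ 2 * ∑ p, ∑ p', (starRingEnd ℂ) (star (u p) ⬝ᵥ u p') * (star (u p) ⬝ᵥ u p') := by
      have e1 : ∑ j, ∑ j', (starRingEnd ℂ) (((a : ℂ))⁻¹ * ∑ p, (star (O j) ⬝ᵥ u p) * (star (u p) ⬝ᵥ O j'))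
          * ∑ p, (star (O j) ⬝ᵥ u p) * (star (u p) ⬝ᵥ O j')
          = ((a : ℂ))⁻¹ * ∑ j, ∑ j', (starRingEnd ℂ) (∑ p, (star (O j) ⬝ᵥ u p) * (star (u p) ⬝ᵥ O j'))
              * ∑ p, (star (O j) ⬝ᵥ u p) * (star (u p) ⬝ᵥ O j') := by
        rw [Finset.mul_sum]
        refine Finset.sum_congr rfl fun j _ => ?_
        rw [Finset.mul_sum]
        refine Finset.sum_congr rfl fun j' _ => ?_
        rw [map_mul, map_inv₀, Complex.conj_ofReal]
        ring
      have e2 : ((a : ℂ)) ^ 2 * ∑ p, ((a : ℂ))⁻¹ * ∑ p', (star (u p) ⬝ᵥ u p') * (star (u p') ⬝ᵥ u p)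
          = ((a : ℂ))⁻¹ * (((a : ℂ)) ^ 2
              * ∑ p, ∑ p', (starRingEnd ℂ) (star (u p) ⬝ᵥ u p') * (star (u p) ⬝ᵥ u p')) := by
        rw [← Finset.mul_sum, ← mul_assoc, mul_comm (((a : ℂ)) ^ 2), mul_assoc]
        congr 2
        refine Finset.sum_congr rfl fun p _ => Finset.sum_congr rfl fun p' _ => ?_
        rw [conj_star_dotProduct, mul_comm]
      rw [e1, e2] at h
      exact mul_left_cancel₀ (inv_ne_zero ha0) h
    simp_rw [conj_mul_self_eq_norm_sq] at h'
    exact_mod_cast h'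
  -- (E3) the Hilbert–Schmidt norm of `c`
  have hC : ∑ j, ∑ j', ‖star (O j) ⬝ᵥ (E.effect k *ᵥ O j')‖ ^ 2 ≤ a * ∑ j, (E.weight (O j) k).re := by
    rw [Finset.sum_comm, Finset.mul_sum]
    refine Finset.sum_le_sum fun j' _ => ?_
    calc ∑ j, ‖star (O j) ⬝ᵥ (E.effect k *ᵥ O j')‖ ^ 2
        ≤ a * (star (E.effect k *ᵥ O j') ⬝ᵥ (E.effect k *ᵥ O j')).re :=
          sum_normSq_dotProduct_le O ha hO _
      _ ≤ a * (E.weight (O j') k).re := mul_le_mul_of_nonneg_left (E.re_star_mulVec_self_le _ _) ha.le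
  -- (D) Cauchy–Schwarz
  have hD := norm_sq_sum_sum_conj_mul_le (fun j j' => star (O j) ⬝ᵥ (E.effect k *ᵥ O j'))
    (fun j j' => ∑ p, (star (O j) ⬝ᵥ u p) * (star (u p) ⬝ᵥ O j'))
  rw [hA, hB] at hD
  -- the pairing is `a²·Σ_p w_p`, of norm at least its real part `a²·𝔖 ≥ 0`
  set 𝔖 : ℝ := ∑ p, (E.weight (u p) k).re with h𝔖
  set 𝒯 : ℝ := ∑ j, (E.weight (O j) k).re with h𝒯
  set G : ℝ := ∑ p, ∑ p', ‖star (u p) ⬝ᵥ u p'‖ ^ 2 with hG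
  have h𝔖0 : 0 ≤ 𝔖 := Finset.sum_nonneg fun p _ => E.weight_re_nonneg _ _
  have hG0 : 0 ≤ G := Finset.sum_nonneg fun p _ => Finset.sum_nonneg fun p' _ => sq_nonneg _
  have hre : (((a : ℂ)) ^ 2 * ∑ p, E.weight (u p) k).re = a ^ 2 * 𝔖 := by
    rw [h𝔖, ← Complex.re_sum]
    have : ((a : ℂ)) ^ 2 = (((a ^ 2 : ℝ)) : ℂ) := by push_cast; ring
    rw [this, Complex.re_ofReal_mul]
  have hlow : a ^ 2 * 𝔖 ≤ ‖((a : ℂ)) ^ 2 * ∑ p, E.weight (u p) k‖ := by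
    rw [← hre]; exact Complex.re_le_norm _
  have h1 : (a ^ 2 * 𝔖) ^ 2 ≤ (a * 𝒯) * (a ^ 2 * G) := by
    have h0 : 0 ≤ a ^ 2 * 𝔖 := by positivity
    calc (a ^ 2 * 𝔖) ^ 2 ≤ ‖((a : ℂ)) ^ 2 * ∑ p, E.weight (u p) k‖ ^ 2 := pow_le_pow_left₀ h0 hlow 2
      _ ≤ _ := hD.trans (mul_le_mul_of_nonneg_right hC (by positivity))
  have h2 : a ^ 4 * 𝔖 ^ 2 ≤ a ^ 4 * (𝒯 / a * G) := by
    have e : (a * 𝒯) * (a ^ 2 * G) = a ^ 4 * (𝒯 / a * G) := by field_simp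
    nlinarith [h1, e]
  exact le_of_mul_le_mul_left h2 (by positivity)

end LA

/-! ## Part II.  `q ≥ 3` mutually unbiased orthogonal frames of size `q²`: constancy below `1/(q² + 1)` -/

section MUB

variable {X : Type*} [Fintype X] [DecidableEq X]
variable {I J : Type*} [Fintype I] [DecidableEq I] [Fintype J] [DecidableEq J]

omit [DecidableEq I] in
/-- A sum over the index set `{(s, j) : j ∈ W_s}` is a double sum. [folklore] -/
theorem sum_highSet_eq {M : Type*} [AddCommMonoid M] (W : I → Finset J) (f : I × J → M) :
    ∑ x ∈ Finset.univ.filter (fun x : I × J => x.2 ∈ W x.1), f x = ∑ s, ∑ j ∈ W s, f (s, j) := by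
  rw [Finset.sum_filter, Fintype.sum_prod_type]
  refine Finset.sum_congr rfl fun s _ => ?_
  dsimp only
  rw [Finset.sum_ite_mem, Finset.univ_inter]

namespace MUBFrames

variable {q : ℕ} {a : ℝ} {z : I → J → X → ℂ}
variable {κ : Type*} [Fintype κ] [DecidableEq κ]

omit [DecidableEq I] in
/-- **The frame trace from above, keeping the high weights:** with `W` the set of `A`-high vectors of
family `s`, `Σ_j ⟨z_{s,j}|E_A|z_{s,j}⟩ ≤ Σ_{j ∈ W} ⟨z_{s,j}|E_A|z_{s,j}⟩ + (q² − #W)·εa`.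
[cite: NielsenChuang2010, §2.2.6 p. 90] -/
theorem trace_le' (hF : MUBFrames q a z) (E : POVM X κ) {ε : ℝ} {s : I} {A : κ}
    (hE : ∀ j, ∃ k, E.AlmostCertain ε (z s j) k)
    (W : Finset J) (hW : ∀ j, j ∈ W ↔ E.AlmostCertain ε (z s j) A) :
    ∑ j, (E.weight (z s j) A).re
      ≤ ∑ j ∈ W, (E.weight (z s j) A).re + ((q : ℝ) ^ 2 - W.card) * (ε * a) := by
  classical
  have hsplit := (Finset.sum_filter_add_sum_filter_not Finset.univ (fun j => j ∈ W)
    fun j => (E.weight (z s j) A).re).symm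
  have hf1 : Finset.univ.filter (fun j => j ∈ W) = W := by ext j; simp
  have hcard2 : ((Finset.univ.filter fun j => ¬ j ∈ W).card : ℝ) = (q : ℝ) ^ 2 - W.card := by
    have h := Finset.card_filter_add_card_filter_not (s := Finset.univ) (fun j => j ∈ W)
    rw [hf1, Finset.card_univ, hF.cardJ] at h
    have h' : ((W.card + (Finset.univ.filter fun j => ¬ j ∈ W).card : ℕ) : ℝ) = ((q ^ 2 : ℕ) : ℝ) := by
      exact_mod_cast h
    push_cast at h'
    linarith
  rw [hsplit, hf1]
  have h2 : ∑ j ∈ Finset.univ.filter (fun j => ¬ j ∈ W), (E.weight (z s j) A).re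
      ≤ (Finset.univ.filter (fun j => ¬ j ∈ W)).card * (ε * a) := by
    have := Finset.sum_le_card_nsmul (Finset.univ.filter (fun j => ¬ j ∈ W))
      (fun j => (E.weight (z s j) A).re) (ε * a)
      (fun j hj => hF.weight_re_le_of_not_ac E (hE j)
        (fun h => (Finset.mem_filter.1 hj).2 ((hW j).2 h)))
    rwa [nsmul_eq_mul] at this
  rw [hcard2] at h2
  linarith

omit [DecidableEq I] [DecidableEq κ] in
/-- The high vectors of a family weigh at least `(1 − ε)a` each: `#W·(1 − ε)a ≤ Σ_{j ∈ W} ⟨z_{s,j}|E_A|z_{s,j}⟩`.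
[cite: NielsenChuang2010, §2.2.6 p. 90] -/
theorem card_mul_le_sum_high (hF : MUBFrames q a z) (E : POVM X κ) {ε : ℝ} {s : I} {A : κ}
    (W : Finset J) (hW : ∀ j, j ∈ W ↔ E.AlmostCertain ε (z s j) A) :
    (W.card : ℝ) * ((1 - ε) * a) ≤ ∑ j ∈ W, (E.weight (z s j) A).re := by
  have := Finset.card_nsmul_le_sum W (fun j => (E.weight (z s j) A).re) ((1 - ε) * a)
    (fun j hj => by
      have h := (hW j).1 hj
      unfold POVM.AlmostCertain at h
      rwa [hF.re_self] at h)
  rwa [nsmul_eq_mul] at this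

omit [DecidableEq I] in
/-- **All families have the same number of `A`-high vectors** (when `ε(q² + 1) < 1`): the frame trace is
family-independent and sandwiched between `#W_r(1 − ε)a` and `#W_s a + (q² − #W_s)εa`, whose gap is `< a`.
[folklore] -/
theorem card_high_le (hF : MUBFrames q a z) (E : POVM X κ) {ε : ℝ} (hε : ε * ((q : ℝ) ^ 2 + 1) < 1)
    (hE : ∀ i j, ∃ k, E.AlmostCertain ε (z i j) k) {A : κ} (r s : I) (Wr Ws : Finset J)
    (hWr : ∀ j, j ∈ Wr ↔ E.AlmostCertain ε (z r j) A) (hWs : ∀ j, j ∈ Ws ↔ E.AlmostCertain ε (z s j) A) :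
    Wr.card ≤ Ws.card := by
  have ha := hF.apos
  have h1 := hF.card_mul_le_sum_high E Wr hWr
  have h2 : ∑ j ∈ Wr, (E.weight (z r j) A).re ≤ ∑ j, (E.weight (z r j) A).re :=
    Finset.sum_le_sum_of_subset_of_nonneg (Finset.subset_univ _) fun j _ _ => E.weight_re_nonneg _ _
  rw [hF.trace_weight_eq E A r s] at h2
  have h3 := hF.trace_le E (hE s) Ws hWs
  have h4 : (((Wr.card : ℝ) - Ws.card) * (1 - ε)) * a ≤ ((q : ℝ) ^ 2 * ε) * a := by nlinarith
  have h5 : ((Wr.card : ℝ) - Ws.card) * (1 - ε) ≤ (q : ℝ) ^ 2 * ε := le_of_mul_le_mul_right h4 ha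
  have h1e : 0 < 1 - ε := by nlinarith [sq_nonneg (q : ℝ)]
  have h6 : (Wr.card : ℝ) - Ws.card < 1 := by
    by_contra hge
    push Not at hge
    nlinarith
  have h7 : (Wr.card : ℝ) < Ws.card + 1 := by linarith
  have h8 : Wr.card < Ws.card + 1 := by exact_mod_cast h7
  omega

omit [DecidableEq X] in
/-- **The Gram row of one high vector:** against all high vectors (`n` per family),
`Σ_{s′} Σ_{j′ ∈ W_{s′}} ‖⟨z_{s,i}|z_{s′,j′}⟩‖² ≤ a² + (q − 1)·n·(a/q)²` (its own family contributes at most `a²`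
by Bessel, each other family exactly `n(a/q)²`). [folklore] -/
theorem gram_row_le (hF : MUBFrames q a z) (s : I) (i : J) (Wf : I → Finset J) {n : ℕ}
    (hcard : ∀ s', (Wf s').card = n) :
    ∑ s', ∑ j' ∈ Wf s', ‖star (z s i) ⬝ᵥ z s' j'‖ ^ 2 ≤ a ^ 2 + ((q : ℝ) - 1) * n * (a / q) ^ 2 := by
  rw [← Finset.add_sum_erase _ _ (Finset.mem_univ s)]
  have h1 : ∑ j' ∈ Wf s, ‖star (z s i) ⬝ᵥ z s j'‖ ^ 2 ≤ a ^ 2 := by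
    calc ∑ j' ∈ Wf s, ‖star (z s i) ⬝ᵥ z s j'‖ ^ 2 ≤ ∑ j', ‖star (z s i) ⬝ᵥ z s j'‖ ^ 2 :=
          Finset.sum_le_sum_of_subset_of_nonneg (Finset.subset_univ _) fun _ _ _ => sq_nonneg _
      _ = ∑ j', ‖star (z s j') ⬝ᵥ z s i‖ ^ 2 :=
          Finset.sum_congr rfl fun j' _ => by rw [norm_star_dotProduct_comm]
      _ = a * (star (z s i) ⬝ᵥ z s i).re := hF.bessel s s i
      _ = a ^ 2 := by rw [hF.re_self, sq]
  have h2 : ∀ s' ∈ Finset.univ.erase s, ∑ j' ∈ Wf s', ‖star (z s i) ⬝ᵥ z s' j'‖ ^ 2 = n * (a / q) ^ 2 := by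
    intro s' hs'
    have hne : s ≠ s' := (Finset.ne_of_mem_erase hs').symm
    rw [Finset.sum_congr rfl fun j' _ => hF.mub s s' hne i j', Finset.sum_const, hcard s', nsmul_eq_mul]
  rw [Finset.sum_congr rfl h2, Finset.sum_const, Finset.card_erase_of_mem (Finset.mem_univ s),
    Finset.card_univ, hF.cardI, nsmul_eq_mul, Nat.cast_sub hF.qpos, Nat.cast_one]
  linarith

set_option maxHeartbeats 400000 in
omit [DecidableEq I] in
/-- **The key inequality.**  If `A` is almost certain somewhere, `ε(q² + 1) < 1`, and the set `W` of `A`-high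
vectors of family `r` has `2·#W ≤ q²`, then with `n = #W ≥ 1`:
`n q³ (1 − ε)² ≤ (q² + (q − 1)n)·(n(1 − ε) + (q² − n)ε)` — the core inequality `𝔖² ≤ (𝒯/a)·G` of
`sq_sum_weight_le` with `𝔖 ≥ qn(1 − ε)a`, `q𝒯 ≤ 𝔖 + q(q² − n)εa`, `qG ≤ a²n(q² + (q − 1)n)`.
[folklore] [cite: NielsenChuang2010, §2.2.6 p. 90, Box 2.3 p. 87] -/
theorem key_ineq (hF : MUBFrames q a z) (E : POVM X κ) {ε : ℝ} (hε : ε * ((q : ℝ) ^ 2 + 1) < 1)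
    (hE : ∀ i j, ∃ k, E.AlmostCertain ε (z i j) k) {A : κ} {i₀ : I} {j₀ : J}
    (hA : E.AlmostCertain ε (z i₀ j₀) A) (r : I) (W : Finset J)
    (hW : ∀ j, j ∈ W ↔ E.AlmostCertain ε (z r j) A) (hhalf : 2 * W.card ≤ q ^ 2) :
    (W.card : ℝ) * (q : ℝ) ^ 3 * (1 - ε) ^ 2
      ≤ ((q : ℝ) ^ 2 + ((q : ℝ) - 1) * W.card)
          * ((W.card : ℝ) * (1 - ε) + ((q : ℝ) ^ 2 - W.card) * ε) := by
  classical
  have ha := hF.apos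
  have hε0 : 0 ≤ ε := hF.eps_nonneg E hA
  have hq1 : (1 : ℝ) ≤ q := by exact_mod_cast hF.qpos
  have hQ0 : (0 : ℝ) < q := by linarith
  have hε1 : ε < 1 := by nlinarith [mul_nonneg hε0 (sq_nonneg (q : ℝ))]
  -- the high sets of all families, all of size `W.card`
  set Wf : I → Finset J := fun s => Finset.univ.filter fun j => E.AlmostCertain ε (z s j) A with hWfd
  have hWf : ∀ s j, j ∈ Wf s ↔ E.AlmostCertain ε (z s j) A := fun s j => by simp [hWfd]
  have hcard : ∀ s, (Wf s).card = W.card := fun s =>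
    le_antisymm (hF.card_high_le E hε hE s r (Wf s) W (hWf s) hW)
      (hF.card_high_le E hε hE r s W (Wf s) hW (hWf s))
  have h1 : 1 ≤ W.card := by
    obtain ⟨j, hj⟩ := hF.exists_ac E hε hE hA r
    exact Finset.card_pos.2 ⟨j, (hW j).2 hj⟩
  have hn1 : (1 : ℝ) ≤ W.card := by exact_mod_cast h1
  have hn2 : 2 * (W.card : ℝ) ≤ (q : ℝ) ^ 2 := by exact_mod_cast hhalf
  have hq2 : (2 : ℝ) ≤ q := by
    have h2q : 2 ≤ q := by nlinarith [hhalf, h1, Nat.zero_le q]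
    exact_mod_cast h2q
  -- the set of all high vectors, of size `q·#W`
  set H : Finset (I × J) := Finset.univ.filter fun x : I × J => x.2 ∈ Wf x.1 with hHd
  have hHcard : (H.card : ℝ) = q * W.card := by
    have : H.card = ∑ s : I, (Wf s).card := by
      rw [Finset.card_eq_sum_ones, hHd, sum_highSet_eq Wf (fun _ => 1)]
      exact Finset.sum_congr rfl fun s _ => (Finset.card_eq_sum_ones _).symm
    rw [this, Finset.sum_congr rfl fun s _ => hcard s, Finset.sum_const, Finset.card_univ, hF.cardI,
      smul_eq_mul, Nat.cast_mul]
  -- the core inequality in the coordinates of frame `r`, with `u` = all high vectors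
  have core := sq_sum_weight_le E A (z r) ha (hF.orth r) (P := ↥H) (fun p => z p.1.1 p.1.2)
    (fun p => hF.expand r p.1.1 p.1.2) (fun p => hF.re_self p.1.1 p.1.2)
  have e1 : ∑ p : ↥H, (E.weight (z p.1.1 p.1.2) A).re = ∑ x ∈ H, (E.weight (z x.1 x.2) A).re :=
    Finset.sum_coe_sort H (fun x => (E.weight (z x.1 x.2) A).re)
  have e2 : ∑ p : ↥H, ∑ p' : ↥H, ‖star (z p.1.1 p.1.2) ⬝ᵥ z p'.1.1 p'.1.2‖ ^ 2
      = ∑ x ∈ H, ∑ x' ∈ H, ‖star (z x.1 x.2) ⬝ᵥ z x'.1 x'.2‖ ^ 2 := by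
    rw [← Finset.sum_coe_sort H (fun x => ∑ x' ∈ H, ‖star (z x.1 x.2) ⬝ᵥ z x'.1 x'.2‖ ^ 2)]
    exact Finset.sum_congr rfl fun p _ =>
      Finset.sum_coe_sort H (fun x' => ‖star (z p.1.1 p.1.2) ⬝ᵥ z x'.1 x'.2‖ ^ 2)
  rw [e1, e2] at core
  have eS : ∑ x ∈ H, (E.weight (z x.1 x.2) A).re = ∑ s, ∑ j ∈ Wf s, (E.weight (z s j) A).re :=
    sum_highSet_eq Wf (fun x => (E.weight (z x.1 x.2) A).re)
  -- (i) `𝔖 ≥ q·n·(1 − ε)a`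
  have hS : (q : ℝ) * W.card * ((1 - ε) * a) ≤ ∑ x ∈ H, (E.weight (z x.1 x.2) A).re := by
    rw [eS]
    have hs : ∀ s, (W.card : ℝ) * ((1 - ε) * a) ≤ ∑ j ∈ Wf s, (E.weight (z s j) A).re := fun s => by
      have h := hF.card_mul_le_sum_high E (Wf s) (hWf s)
      rwa [hcard s] at h
    calc (q : ℝ) * W.card * ((1 - ε) * a) = ∑ _s : I, (W.card : ℝ) * ((1 - ε) * a) := by
          rw [Finset.sum_const, Finset.card_univ, hF.cardI, nsmul_eq_mul]; ring
      _ ≤ _ := Finset.sum_le_sum fun s _ => hs s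
  -- (ii) `q𝒯 ≤ 𝔖 + q(q² − n)εa`
  have hT : (q : ℝ) * ∑ j, (E.weight (z r j) A).re
      ≤ ∑ x ∈ H, (E.weight (z x.1 x.2) A).re + q * (((q : ℝ) ^ 2 - W.card) * (ε * a)) := by
    rw [eS]
    have hs : ∀ s, ∑ j, (E.weight (z r j) A).re
        ≤ ∑ j ∈ Wf s, (E.weight (z s j) A).re + ((q : ℝ) ^ 2 - W.card) * (ε * a) := fun s => by
      have h := hF.trace_le' E (hE s) (Wf s) (hWf s)
      rw [hcard s, ← hF.trace_weight_eq E A r s] at h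
      exact h
    calc (q : ℝ) * ∑ j, (E.weight (z r j) A).re = ∑ _s : I, ∑ j, (E.weight (z r j) A).re := by
          rw [Finset.sum_const, Finset.card_univ, hF.cardI, nsmul_eq_mul]
      _ ≤ ∑ s : I, (∑ j ∈ Wf s, (E.weight (z s j) A).re + ((q : ℝ) ^ 2 - W.card) * (ε * a)) :=
          Finset.sum_le_sum fun s _ => hs s
      _ = _ := by
          rw [Finset.sum_add_distrib, Finset.sum_const, Finset.card_univ, hF.cardI, nsmul_eq_mul]
  -- (iii) `G ≤ a²n(q² + (q − 1)n)/q`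
  have hG : ∑ x ∈ H, ∑ x' ∈ H, ‖star (z x.1 x.2) ⬝ᵥ z x'.1 x'.2‖ ^ 2
      ≤ a ^ 2 * W.card * ((q : ℝ) ^ 2 + ((q : ℝ) - 1) * W.card) / q := by
    have row : ∀ x ∈ H, ∑ x' ∈ H, ‖star (z x.1 x.2) ⬝ᵥ z x'.1 x'.2‖ ^ 2
        ≤ a ^ 2 + ((q : ℝ) - 1) * W.card * (a / q) ^ 2 := fun x _ => by
      rw [sum_highSet_eq Wf (fun x' => ‖star (z x.1 x.2) ⬝ᵥ z x'.1 x'.2‖ ^ 2)]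
      exact hF.gram_row_le x.1 x.2 Wf hcard
    calc ∑ x ∈ H, ∑ x' ∈ H, ‖star (z x.1 x.2) ⬝ᵥ z x'.1 x'.2‖ ^ 2
        ≤ ∑ _x ∈ H, (a ^ 2 + ((q : ℝ) - 1) * W.card * (a / q) ^ 2) := Finset.sum_le_sum row
      _ = H.card * (a ^ 2 + ((q : ℝ) - 1) * W.card * (a / q) ^ 2) := by
          rw [Finset.sum_const, nsmul_eq_mul]
      _ = a ^ 2 * W.card * ((q : ℝ) ^ 2 + ((q : ℝ) - 1) * W.card) / q := by
          rw [hHcard]; field_simp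
  have hG0 : 0 ≤ ∑ x ∈ H, ∑ x' ∈ H, ‖star (z x.1 x.2) ⬝ᵥ z x'.1 x'.2‖ ^ 2 :=
    Finset.sum_nonneg fun _ _ => Finset.sum_nonneg fun _ _ => sq_nonneg _
  -- (iv) elimination of `𝔖, 𝒯, G`
  generalize ∑ x ∈ H, (E.weight (z x.1 x.2) A).re = S at core hS hT
  generalize ∑ j, (E.weight (z r j) A).re = T at core hT
  generalize ∑ x ∈ H, ∑ x' ∈ H, ‖star (z x.1 x.2) ⬝ᵥ z x'.1 x'.2‖ ^ 2 = G at core hG hG0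
  generalize (W.card : ℝ) = n at hn1 hn2 hS hT hG ⊢
  have hSpos : 0 ≤ S :=
    le_trans (mul_nonneg (mul_nonneg hQ0.le (by linarith)) (mul_nonneg (by linarith) ha.le)) hS
  have core1 : a * S ^ 2 ≤ T * G := by
    have h := mul_le_mul_of_nonneg_left core ha.le
    have e : a * (T / a * G) = T * G := by field_simp
    linarith
  have step2 : (q : ℝ) * a * S ^ 2 ≤ (S + q * (((q : ℝ) ^ 2 - n) * (ε * a))) * G := by
    have h₁ : (q : ℝ) * (a * S ^ 2) ≤ q * (T * G) := mul_le_mul_of_nonneg_left core1 hQ0.le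
    have h₂ : ((q : ℝ) * T) * G ≤ (S + q * (((q : ℝ) ^ 2 - n) * (ε * a))) * G :=
      mul_le_mul_of_nonneg_right hT hG0
    linarith
  have hSεpos : 0 ≤ S + q * (((q : ℝ) ^ 2 - n) * (ε * a)) :=
    add_nonneg hSpos (mul_nonneg hQ0.le (mul_nonneg (by linarith) (mul_nonneg hε0 ha.le)))
  have step3 : (q : ℝ) * a * S ^ 2
      ≤ (S + q * (((q : ℝ) ^ 2 - n) * (ε * a))) * (a ^ 2 * n * ((q : ℝ) ^ 2 + ((q : ℝ) - 1) * n) / q) :=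
    step2.trans (mul_le_mul_of_nonneg_left hG hSεpos)
  have step4 : (q : ℝ) ^ 2 * S ^ 2
      ≤ (S + q * (((q : ℝ) ^ 2 - n) * (ε * a))) * (a * n * ((q : ℝ) ^ 2 + ((q : ℝ) - 1) * n)) := by
    have h := mul_le_mul_of_nonneg_left step3 hQ0.le
    have e : (q : ℝ) * ((S + q * (((q : ℝ) ^ 2 - n) * (ε * a)))
          * (a ^ 2 * n * ((q : ℝ) ^ 2 + ((q : ℝ) - 1) * n) / q))
        = a * ((S + q * (((q : ℝ) ^ 2 - n) * (ε * a))) * (a * n * ((q : ℝ) ^ 2 + ((q : ℝ) - 1) * n))) := by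
      field_simp
    rw [e] at h
    have h' : a * ((q : ℝ) ^ 2 * S ^ 2)
        ≤ a * ((S + q * (((q : ℝ) ^ 2 - n) * (ε * a))) * (a * n * ((q : ℝ) ^ 2 + ((q : ℝ) - 1) * n))) := by
      linarith
    exact le_of_mul_le_mul_left h' ha
  -- monotone substitution `S ↦ S₀ = q n (1 − ε) a ≤ S` in `q²S² − (anL)S`
  have cL : a * n * ((q : ℝ) ^ 2 + ((q : ℝ) - 1) * n) ≤ 2 * (q : ℝ) ^ 2 * (q * n * ((1 - ε) * a)) := by
    have hL : (q : ℝ) ^ 2 + ((q : ℝ) - 1) * n ≤ 2 * (q : ℝ) ^ 3 * (1 - ε) := by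
      have hεq : ε * (q : ℝ) ^ 2 < 1 := by nlinarith [mul_nonneg hε0 (sq_nonneg (q : ℝ))]
      have hεq3 : (q : ℝ) * (ε * (q : ℝ) ^ 2) < q * 1 := mul_lt_mul_of_pos_left hεq hQ0
      nlinarith [mul_nonneg (by linarith : (0 : ℝ) ≤ (q : ℝ) - 1) (by linarith : (0 : ℝ) ≤ (q : ℝ) ^ 2 - 2 * n),
        mul_nonneg (mul_nonneg hQ0.le (by linarith : (0 : ℝ) ≤ 3 * (q : ℝ) - 4))
          (by linarith : (0 : ℝ) ≤ (q : ℝ) + 1)]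
    have := mul_le_mul_of_nonneg_left hL (mul_nonneg ha.le (by linarith : (0 : ℝ) ≤ n))
    exact this.trans_eq (by ring)
  have mono : (q : ℝ) ^ 2 * (q * n * ((1 - ε) * a)) ^ 2
        - (a * n * ((q : ℝ) ^ 2 + ((q : ℝ) - 1) * n)) * (q * n * ((1 - ε) * a))
      ≤ (q : ℝ) ^ 2 * S ^ 2 - (a * n * ((q : ℝ) ^ 2 + ((q : ℝ) - 1) * n)) * S := by
    have hd : 0 ≤ S - q * n * ((1 - ε) * a) := sub_nonneg.2 hS
    have hm : 0 ≤ (q : ℝ) ^ 2 * (S + q * n * ((1 - ε) * a)) - a * n * ((q : ℝ) ^ 2 + ((q : ℝ) - 1) * n) := by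
      linarith [mul_nonneg (sq_nonneg (q : ℝ)) hd]
    linarith [mul_nonneg hd hm]
  have fin : (q : ℝ) ^ 2 * (q * n * ((1 - ε) * a)) ^ 2
        - (a * n * ((q : ℝ) ^ 2 + ((q : ℝ) - 1) * n)) * (q * n * ((1 - ε) * a))
      ≤ (q * (((q : ℝ) ^ 2 - n) * (ε * a))) * (a * n * ((q : ℝ) ^ 2 + ((q : ℝ) - 1) * n)) := by
    linarith
  have hpos : 0 < (q : ℝ) * a ^ 2 * n := mul_pos (mul_pos hQ0 (pow_pos ha 2)) (by linarith)
  have fin' : (q : ℝ) * a ^ 2 * n * (n * (q : ℝ) ^ 3 * (1 - ε) ^ 2)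
      ≤ (q : ℝ) * a ^ 2 * n
          * (((q : ℝ) ^ 2 + ((q : ℝ) - 1) * n) * (n * (1 - ε) + ((q : ℝ) ^ 2 - n) * ε)) := by
    linarith
  exact le_of_mul_le_mul_left fin' hpos

/-- **The polynomial inequality** `n q⁷ ≥ (q² + 1)(q²(n + 1) − n)(q² + (q − 1)n)` for `q ≥ 3`,
`1 ≤ n ≤ q²/2` (it FAILS at `q = 2`): twice the difference is
`α(n − 1)(q² − 2n) + 2λ(n − 1) + 2P(1)` with `α = q⁵ − q⁴ − q + 1`, `2λ = q⁷ − q⁶ − 4q⁵ + 4q⁴ − q³ + 3q² + 2q − 2`,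
`P(1) = q⁷ − 2q⁶ − 2q⁵ + q⁴ − q³ + 2q² + q − 1`, all non-negative for `q ≥ 3` (positive coefficients in
`q − 3`). [folklore] -/
theorem key_poly_nonneg {q n : ℝ} (hq : 3 ≤ q) (h1 : 1 ≤ n) (h2 : 2 * n ≤ q ^ 2) :
    0 ≤ n * q ^ 7 - (q ^ 2 + 1) * (q ^ 2 * (n + 1) - n) * (q ^ 2 + (q - 1) * n) := by
  obtain ⟨t, ht, rfl⟩ : ∃ t : ℝ, 0 ≤ t ∧ q = t + 3 := ⟨q - 3, by linarith, by ring⟩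
  have t2 := pow_nonneg ht 2
  have t3 := pow_nonneg ht 3
  have t4 := pow_nonneg ht 4
  have t5 := pow_nonneg ht 5
  have t6 := pow_nonneg ht 6
  have t7 := pow_nonneg ht 7
  have hα : 0 ≤ (t + 3) ^ 5 - (t + 3) ^ 4 - (t + 3) + 1 := by nlinarith
  have hl : 0 ≤ (t + 3) ^ 7 - (t + 3) ^ 6 - 4 * (t + 3) ^ 5 + 4 * (t + 3) ^ 4 - (t + 3) ^ 3
      + 3 * (t + 3) ^ 2 + 2 * (t + 3) - 2 := by nlinarith
  have hP1 : 0 ≤ (t + 3) ^ 7 - 2 * (t + 3) ^ 6 - 2 * (t + 3) ^ 5 + (t + 3) ^ 4 - (t + 3) ^ 3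
      + 2 * (t + 3) ^ 2 + (t + 3) - 1 := by nlinarith
  have hn1 : 0 ≤ n - 1 := by linarith
  have hn2 : 0 ≤ (t + 3) ^ 2 - 2 * n := by linarith
  nlinarith [mul_nonneg (mul_nonneg hα hn1) hn2, mul_nonneg hl hn1, hP1]

/-- **The contradiction:** the key inequality is incompatible with `ε(q² + 1) < 1` for `q ≥ 3`,
`1 ≤ n ≤ q²/2`. [folklore] -/
theorem key_contra {q n ε : ℝ} (hq : 3 ≤ q) (h1 : 1 ≤ n) (h2 : 2 * n ≤ q ^ 2)
    (hε : ε * (q ^ 2 + 1) < 1)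
    (key : n * q ^ 3 * (1 - ε) ^ 2 ≤ (q ^ 2 + (q - 1) * n) * (n * (1 - ε) + (q ^ 2 - n) * ε)) :
    False := by
  have hP := key_poly_nonneg hq h1 h2
  have hq0 : 0 < q := by linarith
  have hL : 0 ≤ q ^ 2 + (q - 1) * n := by nlinarith
  have hu : q ^ 2 < (q ^ 2 + 1) * (1 - ε) := by nlinarith
  have hX : 0 < (q ^ 2 + 1) * (1 - ε) := lt_of_le_of_lt (sq_nonneg q) hu
  have hu2 : q ^ 4 < ((q ^ 2 + 1) * (1 - ε)) ^ 2 := by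
    nlinarith [mul_pos (sub_pos.2 hu) (add_pos_of_pos_of_nonneg hX (sq_nonneg q))]
  have hnq : 0 < n * q ^ 3 := mul_pos (by linarith) (pow_pos hq0 3)
  have hlhs : n * q ^ 7 < n * q ^ 3 * ((q ^ 2 + 1) * (1 - ε)) ^ 2 := by
    have := mul_lt_mul_of_pos_left hu2 hnq
    linarith
  have h3 : (q ^ 2 + 1) * (n * (1 - ε) + (q ^ 2 - n) * ε) ≤ q ^ 2 * (n + 1) - n := by
    have : (q ^ 2 - 2 * n) * (ε * (q ^ 2 + 1)) ≤ (q ^ 2 - 2 * n) * 1 :=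
      mul_le_mul_of_nonneg_left hε.le (by linarith)
    nlinarith
  have hrhs : (q ^ 2 + 1) * ((q ^ 2 + 1) * (n * (1 - ε) + (q ^ 2 - n) * ε))
      ≤ (q ^ 2 + 1) * (q ^ 2 * (n + 1) - n) := mul_le_mul_of_nonneg_left h3 (by positivity)
  have hA : (q ^ 2 + 1) ^ 2 * (n * q ^ 3 * (1 - ε) ^ 2) = n * q ^ 3 * ((q ^ 2 + 1) * (1 - ε)) ^ 2 := by
    ring
  have hB : (q ^ 2 + 1) ^ 2 * ((q ^ 2 + (q - 1) * n) * (n * (1 - ε) + (q ^ 2 - n) * ε))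
      = (q ^ 2 + (q - 1) * n) * ((q ^ 2 + 1) * ((q ^ 2 + 1) * (n * (1 - ε) + (q ^ 2 - n) * ε))) := by
    ring
  have hk := mul_le_mul_of_nonneg_left key (sq_nonneg (q ^ 2 + 1))
  rw [hA, hB] at hk
  have hB2 := mul_le_mul_of_nonneg_left hrhs hL
  have : n * q ^ 7 < (q ^ 2 + (q - 1) * n) * ((q ^ 2 + 1) * (q ^ 2 * (n + 1) - n)) := by linarith
  linarith

omit [DecidableEq I] in
/-- **More than half of every family is `A`-high** (`q ≥ 3`): an occurring outcome `A` — almost certain on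
one frame vector anywhere, with `ε(q² + 1) < 1` — is almost certain on MORE THAN HALF of the vectors of
every family.  (For `q ≥ 13` this is (AC) `MUBFrames.half_lt_card`; the present proof by the Hilbert–Schmidt
Cauchy–Schwarz step covers every `q ≥ 3`.) [folklore] [cite: NielsenChuang2010, §2.2.6 p. 90, Box 2.3 p. 87] -/
theorem half_lt_card₃ (hF : MUBFrames q a z) (hq : 3 ≤ q) (E : POVM X κ) {ε : ℝ}
    (hε : ε * ((q : ℝ) ^ 2 + 1) < 1) (hE : ∀ i j, ∃ k, E.AlmostCertain ε (z i j) k) {A : κ} {i₀ : I}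
    {j₀ : J} (hA : E.AlmostCertain ε (z i₀ j₀) A) (r : I)
    (W : Finset J) (hW : ∀ j, j ∈ W ↔ E.AlmostCertain ε (z r j) A) : (q : ℝ) ^ 2 < 2 * W.card := by
  classical
  by_contra hle
  push Not at hle
  have hhalf : 2 * W.card ≤ q ^ 2 := by exact_mod_cast hle
  have h1 : 1 ≤ W.card := by
    obtain ⟨j, hj⟩ := hF.exists_ac E hε hE hA r
    exact Finset.card_pos.2 ⟨j, (hW j).2 hj⟩
  have key := hF.key_ineq E hε hE hA r W hW hhalf
  exact key_contra (by exact_mod_cast hq) (by exact_mod_cast h1) hle hε key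

omit [DecidableEq I] in
/-- **Constancy below `1/(q² + 1)` for every `q ≥ 3`.**  For `q ≥ 3` mutually unbiased orthogonal frames of
size `q²` and a general measurement that is `ε`-almost sure on every frame vector with `ε·(q² + 1) < 1`,
ALL frame vectors have one and the same almost-certain outcome (two different outcomes would each be high
on more than half of one family).  This removes the hypothesis `13 ≤ q` of (AC) `MUBFrames.sameOutcome`;
sharpness at `ε = 1/(q² + 1)` is (AC)'s damped rank-one measurement.  The bound `q ≥ 3` is where the method
stops: for `q = 2` the polynomial inequality `key_poly_nonneg` fails.
[folklore] [cite: NielsenChuang2010, §2.2.6 p. 90, Box 2.3 p. 87] -/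
theorem sameOutcome₃ (hF : MUBFrames q a z) (hq : 3 ≤ q) (E : POVM X κ) {ε : ℝ}
    (hε : ε * ((q : ℝ) ^ 2 + 1) < 1) (hE : ∀ i j, ∃ k, E.AlmostCertain ε (z i j) k)
    {i i' : I} {j j' : J} {k k' : κ} (hk : E.AlmostCertain ε (z i j) k)
    (hk' : E.AlmostCertain ε (z i' j') k') : k = k' := by
  classical
  by_contra hkk
  have hε0 : 0 ≤ ε := hF.eps_nonneg E hk
  have hq' : (3 : ℝ) ≤ q := by exact_mod_cast hq
  have hε2 : ε < 1 / 2 := by nlinarith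
  set W : Finset J := Finset.univ.filter fun j => E.AlmostCertain ε (z i j) k with hWd
  set W' : Finset J := Finset.univ.filter fun j => E.AlmostCertain ε (z i j) k' with hW'd
  have hW : ∀ j, j ∈ W ↔ E.AlmostCertain ε (z i j) k := fun j => by simp [hWd]
  have hW' : ∀ j, j ∈ W' ↔ E.AlmostCertain ε (z i j) k' := fun j => by simp [hW'd]
  have h1 := hF.half_lt_card₃ hq E hε hE hk i W hW
  have h2 := hF.half_lt_card₃ hq E hε hE hk' i W' hW'
  have hdisj : Disjoint W W' := by
    rw [Finset.disjoint_left]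
    intro j hj hj'
    exact hkk (E.almostCertain_unique hε2 (hF.ne_zero i j) ((hW j).1 hj) ((hW' j).1 hj'))
  have hcard : W.card + W'.card ≤ q ^ 2 := by
    rw [← Finset.card_union_of_disjoint hdisj, ← hF.cardJ, ← Finset.card_univ]
    exact Finset.card_le_univ _
  have : ((W.card + W'.card : ℕ) : ℝ) ≤ ((q ^ 2 : ℕ) : ℝ) := by exact_mod_cast hcard
  push_cast at this
  linarith

end MUBFrames

end MUB

/-! ## Part III.  Chen's Step 8: the tolerance threshold `1/(Q² + 1)` for every admissible prime `Q` -/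

namespace Shape

variable (S : Shape)

/-- **PRIME `Q`: THE STEP-8 TOLERANCE CEILING AT THE OPTIMAL CONSTANT `1/(Q² + 1)`.**  If a measurement of the
Step-8 register is `ε`-almost sure on the Karst-wave class `InClass U` of `S` with at least one unknown
tail coordinate (`t₁+1 ∈ U`), `Q` is prime (admissibility gives `Q ≥ 3` odd), and `ε·(Q² + 1) < 1`, then
`|φ7.d⟩` of `S` and of the shifted instance `(b, v′ + 2D²p₁b)` — whose Step-9 requirements differ — get THE
SAME almost-certain outcome.  This is (AC) `Shape.step8_povm_ceiling_prime` WITHOUT its hypothesis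
`13 ≤ Q`: the `Q` dummy-slope families of one `(x, w_{t₁})`-block are `Q` mutually unbiased orthogonal bases
of a `Q²`-space (`Shape.slopeBlock`) and `MUBFrames.sameOutcome₃` covers every `Q ≥ 3`.  HONEST FRAMING: a
theorem about the measurement step of a WITHDRAWN algorithm (Chen, ePrint 2024/555, Step 9 retracted
2024-04-18) — it says exactly how insensitive Step 8's failure is to approximate measurement; it repairs
nothing, breaks nothing, and is not progress on any lattice problem.
[cite: ChenQuantumLattice2024, Lemma 3.13 pp. 32–34, eq. (35) p. 31, §3.5.8 pp. 33–34;
NielsenChuang2010, §2.2.6 p. 90, Box 2.3 p. 87] -/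
theorem step8_povm_ceiling_prime' (h : S.Admissible) (hQ : (S.Q : ℕ).Prime)
    {κ : Type*} [Fintype κ] [DecidableEq κ]
    (U : Finset (Fin (S.n + 1))) (t₁ : Fin S.n) (ht₁ : t₁.succ ∈ U)
    (E : POVM (Fin (S.n + 1) → ZMod S.M) κ) {ε : ℝ}
    (hε : ε * (((S.Q : ℕ) : ℝ) ^ 2 + 1) < 1) (hE : S.AlmostSureOn ε U E)
    {k k' : κ} (hk : E.AlmostCertain ε S.phi7d k)
    (hk' : E.AlmostCertain ε (S.inst S.b (fun i => S.v' i + 2 * (S.D : ℤ) * S.D * S.p₁ * S.b i)).phi7d k') :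
    k = k' := by
  classical
  obtain ⟨c₀, x₀, y₀, hφS, hφS'⟩ : ∃ (c₀ : S.Coset) (x₀ : ZMod S.Q) (y₀ : Fin S.n → ZMod S.Q),
      S.phi7d = (S.cshape c₀).uKet 0 x₀ y₀
      ∧ (S.inst S.b (fun i => S.v' i + 2 * (S.D : ℤ) * S.D * S.p₁ * S.b i)).phi7d
          = (S.cshape c₀).uKet 0 (x₀ - 1) (fun t => y₀ t + ((S.b t.succ : ℤ) : ZMod S.Q)) :=
    ⟨_, _, _, S.phi7d_eq_uKet h, S.phi7d_shift_eq_uKet h⟩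
  have h₀ : (S.cshape c₀).Admissible := S.cshape_admissible h c₀
  have hE₀ : (S.cshape c₀).AlmostSureOn ε U E := fun b₂ v₂ hI => hE b₂ v₂ hI
  -- the two states as straightened members `Z_{x₀, w₀}` and `Z_{x₀ − 1, w₀}`
  set w₀ : Fin S.n → ZMod S.Q := y₀ + x₀ • (S.cshape c₀).bbar with hw₀
  have hz₁ : (S.cshape c₀).zKet x₀ w₀ = S.phi7d := by
    rw [hφS, Shape.zKet, hw₀, add_sub_cancel_right]
  have hz₂ : (S.cshape c₀).zKet (x₀ - 1) w₀
      = (S.inst S.b (fun i => S.v' i + 2 * (S.D : ℤ) * S.D * S.p₁ * S.b i)).phi7d := by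
    rw [hφS', Shape.zKet, hw₀]
    congr 1
    funext t
    rw [Pi.sub_apply, Pi.add_apply, Pi.smul_apply, Pi.smul_apply, smul_eq_mul, smul_eq_mul,
      show (S.cshape c₀).bbar t = ((S.b t.succ : ℤ) : ZMod S.Q) from rfl]
    ring
  -- the slope block at `t₁` through `w₀`
  have hF := (S.cshape c₀).slopeBlock h₀ hQ t₁ w₀
  have hTU : ∀ t ∈ ({t₁} : Finset (Fin S.n)), t.succ ∈ U := fun t ht => by
    rw [Finset.mem_singleton.1 ht]; exact ht₁
  have hEz : ∀ (g : ZMod S.Q) (v : ZMod S.Q × ZMod S.Q),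
      ∃ k, E.AlmostCertain ε ((S.cshape c₀).bKet t₁ g v.1 (Function.update w₀ t₁ v.2)) k := by
    intro g v
    unfold Shape.bKet
    exact (S.cshape c₀).exists_almostCertain_uKet h₀ hTU hE₀ _ _ _
      (fun t ht => by rw [Pi.single_eq_of_ne (fun h' => ht (Finset.mem_singleton.2 h'))])
  have e₁ : S.phi7d = (S.cshape c₀).bKet t₁ 0 (x₀, w₀ t₁).1 (Function.update w₀ t₁ (x₀, w₀ t₁).2) := by
    rw [Function.update_eq_self, ← Shape.zKet_eq_bKet, hz₁]
  have e₂ : (S.inst S.b (fun i => S.v' i + 2 * (S.D : ℤ) * S.D * S.p₁ * S.b i)).phi7d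
      = (S.cshape c₀).bKet t₁ 0 (x₀ - 1, w₀ t₁).1 (Function.update w₀ t₁ (x₀ - 1, w₀ t₁).2) := by
    rw [Function.update_eq_self, ← Shape.zKet_eq_bKet, hz₂]
  rw [e₁] at hk
  rw [e₂] at hk'
  exact hF.sameOutcome₃ h.three_le_Q E hε hEz hk hk'

/-- **Every admissible prime `Q`: the tolerance threshold is EXACTLY `1/(Q² + 1)`.**  Ceiling for every `ε`
with `ε·(Q² + 1) < 1` (`Shape.step8_povm_ceiling_prime'`) and failure at `ε = 1/(Q² + 1)` ((AC)
`Shape.step8_povm_ceiling_fails_at_threshold`, the rank-one measurement along `|φ7.d⟩` damped by `1 − ε`).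
This is (AC) `Shape.step8_povm_ceiling_threshold_prime` WITHOUT `13 ≤ Q`; it closes the window
`[1/(4Q²), 1/(Q² + 1)]` that (Q)/(AC) left for `Q ∈ {3, 5, 7, 11}`.  The composite-`Q` exact constant stays
open (window `[1/(4Q²), 1/(minFac(Q)² + 1)]`).  Adjudication, not a claim of the source; HONEST FRAMING: a
theorem about a WITHDRAWN algorithm, not progress on any lattice problem.
[cite: ChenQuantumLattice2024, Lemma 3.13 pp. 32–34, §3.5.8 pp. 33–34, §3.5.5 pp. 33–37;
NielsenChuang2010, §2.2.6 p. 90, Box 2.3 p. 87] -/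
theorem step8_povm_ceiling_threshold_prime' (h : S.Admissible) (hQ : (S.Q : ℕ).Prime)
    (U : Finset (Fin (S.n + 1))) :
    (∀ {κ : Type} [Fintype κ] [DecidableEq κ] (t₁ : Fin S.n), t₁.succ ∈ U →
        ∀ (E : POVM (Fin (S.n + 1) → ZMod S.M) κ) {ε : ℝ}, ε * (((S.Q : ℕ) : ℝ) ^ 2 + 1) < 1 →
          S.AlmostSureOn ε U E →
            ∀ k k' : κ, E.AlmostCertain ε S.phi7d k →
              E.AlmostCertain ε (S.inst S.b (fun i => S.v' i + 2 * (S.D : ℤ) * S.D * S.p₁ * S.b i)).phi7d k'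
                → k = k')
    ∧ ∃ (E : POVM (Fin (S.n + 1) → ZMod S.M) (Fin 2)) (k k' : Fin 2),
        S.AlmostSureOn (1 / (((S.Q : ℕ) : ℝ) ^ 2 + 1)) U E ∧ k ≠ k'
        ∧ E.AlmostCertain (1 / (((S.Q : ℕ) : ℝ) ^ 2 + 1)) S.phi7d k
        ∧ E.AlmostCertain (1 / (((S.Q : ℕ) : ℝ) ^ 2 + 1))
            (S.inst S.b (fun i => S.v' i + 2 * (S.D : ℤ) * S.D * S.p₁ * S.b i)).phi7d k' := by
  refine ⟨fun t₁ ht₁ E _ hε hE _ _ hk hk' => S.step8_povm_ceiling_prime' h hQ U t₁ ht₁ E hε hE hk hk', ?_⟩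
  have hmf : Nat.minFac (S.Q : ℕ) = (S.Q : ℕ) := hQ.minFac_eq
  have := S.step8_povm_ceiling_fails_at_threshold h U
  rw [hmf] at this
  exact this

/-- **The threshold as a number, every admissible prime `Q`:** for any class with an unknown tail coordinate,
the set of tolerances `ε` at which EVERY `ε`-almost-sure two-outcome measurement gives `S` and
`(b, v′ + 2D²p₁b)` the same almost-certain outcome is exactly the half-line `ε < 1/(Q² + 1)` — (AC)
`Shape.step8_povm_sameOutcome_iff_lt_threshold` WITHOUT `13 ≤ Q`.  Adjudication; HONEST FRAMING as above.
[cite: ChenQuantumLattice2024, Lemma 3.13 pp. 32–34, §3.5.8 pp. 33–34] -/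
theorem step8_povm_sameOutcome_iff_lt_threshold' (h : S.Admissible) (hQ : (S.Q : ℕ).Prime)
    (U : Finset (Fin (S.n + 1))) (t₁ : Fin S.n) (ht₁ : t₁.succ ∈ U) (ε : ℝ) :
    (∀ (E : POVM (Fin (S.n + 1) → ZMod S.M) (Fin 2)), S.AlmostSureOn ε U E →
        ∀ k k' : Fin 2, E.AlmostCertain ε S.phi7d k →
          E.AlmostCertain ε (S.inst S.b (fun i => S.v' i + 2 * (S.D : ℤ) * S.D * S.p₁ * S.b i)).phi7d k'
            → k = k')
      ↔ ε < 1 / (((S.Q : ℕ) : ℝ) ^ 2 + 1) := by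
  have hpos : (0 : ℝ) < ((S.Q : ℕ) : ℝ) ^ 2 + 1 := by positivity
  constructor
  · intro H
    by_contra hge
    push Not at hge
    obtain ⟨E, k, k', hE, hkk, hk, hk'⟩ := (S.step8_povm_ceiling_threshold_prime' h hQ U).2
    -- monotonicity in `ε`: an `ε⋆`-almost-sure measurement is `ε`-almost sure for `ε ≥ ε⋆`
    have mono : ∀ {φ : (Fin (S.n + 1) → ZMod S.M) → ℂ} {j : Fin 2},
        E.AlmostCertain (1 / (((S.Q : ℕ) : ℝ) ^ 2 + 1)) φ j → E.AlmostCertain ε φ j := by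
      intro φ j hj
      unfold POVM.AlmostCertain at hj ⊢
      have hN := star_dotProduct_self_re_nonneg φ
      nlinarith
    exact hkk (H E (fun b₂ v₂ hI => (hE b₂ v₂ hI).imp fun j hj => mono hj) k k' (mono hk) (mono hk'))
  · intro hlt E hE k k' hk hk'
    have hε : ε * (((S.Q : ℕ) : ℝ) ^ 2 + 1) < 1 := by rwa [lt_div_iff₀ hpos] at hlt
    exact S.step8_povm_ceiling_prime' h hQ U t₁ ht₁ E hε hE hk hk'

/-- **The exact Step-8 tolerance constant for every admissible PRIME modulus, as one statement:** for an
admissible shape with `Q` prime and any Karst-wave class with an unknown tail coordinate, (i) below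
`1/(Q² + 1)` every almost-sure general measurement (any outcome set) confuses `S` with `(b, v′ + 2D²p₁b)`, and
(ii) at `1/(Q² + 1)` a two-outcome almost-sure measurement separates them.  Supersedes, for prime `Q`, the
order-of-magnitude window `[1/(4Q²), 1/Q²]` of (Q) and the `Q ≥ 13` restriction of (AC).  HONEST FRAMING: a
kernel-checked constant about a WITHDRAWN algorithm's measurement step — not summit progress.
[cite: ChenQuantumLattice2024, Lemma 3.13 pp. 32–34, §3.5.8 pp. 33–34, §3.5.5 pp. 33–37] -/
theorem step8_tolerance_threshold_all_primes (h : S.Admissible) (hQ : (S.Q : ℕ).Prime)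
    (U : Finset (Fin (S.n + 1))) (t₁ : Fin S.n) (ht₁ : t₁.succ ∈ U) :
    (∀ {κ : Type} [Fintype κ] [DecidableEq κ] (E : POVM (Fin (S.n + 1) → ZMod S.M) κ) {ε : ℝ},
        ε < 1 / (((S.Q : ℕ) : ℝ) ^ 2 + 1) → S.AlmostSureOn ε U E →
          ∀ k k' : κ, E.AlmostCertain ε S.phi7d k →
            E.AlmostCertain ε (S.inst S.b (fun i => S.v' i + 2 * (S.D : ℤ) * S.D * S.p₁ * S.b i)).phi7d k'
              → k = k')
    ∧ ∃ (E : POVM (Fin (S.n + 1) → ZMod S.M) (Fin 2)) (k k' : Fin 2),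
        S.AlmostSureOn (1 / (((S.Q : ℕ) : ℝ) ^ 2 + 1)) U E ∧ k ≠ k'
        ∧ E.AlmostCertain (1 / (((S.Q : ℕ) : ℝ) ^ 2 + 1)) S.phi7d k
        ∧ E.AlmostCertain (1 / (((S.Q : ℕ) : ℝ) ^ 2 + 1))
            (S.inst S.b (fun i => S.v' i + 2 * (S.D : ℤ) * S.D * S.p₁ * S.b i)).phi7d k' := by
  have hpos : (0 : ℝ) < ((S.Q : ℕ) : ℝ) ^ 2 + 1 := by positivity
  refine ⟨fun E ε hlt hE _ _ hk hk' => ?_, (S.step8_povm_ceiling_threshold_prime' h hQ U).2⟩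
  have hε : ε * (((S.Q : ℕ) : ℝ) ^ 2 + 1) < 1 := by rwa [lt_div_iff₀ hpos] at hlt
  exact S.step8_povm_ceiling_prime' h hQ U t₁ ht₁ E hε hE hk hk'

end Shape

end Literature.Computability.Cryptography.Chen2024
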